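import Summits.AtomisticToContinuum.BoseEinsteinCondensation.Theorems.BECGroundStateSOSPeriodicIRBoundDefs
import Summits.AtomisticToContinuum.BoseEinsteinCondensation.Theorems.PeriodicIRBound.Negative.NormalForms
import Summits.AtomisticToContinuum.BoseEinsteinCondensation.Theorems.BECThomsonPrincipleDensityResponseKineticSignCoherence
import Literature.Barriers.AtomisticToContinuum.KineticGapLengthScalesThermodynamicWindow
import HarnessLib

/-!
# Route `BECGroundStateSOS`, crux `PeriodicIRBound` (stmt-AtomisticToContinuum-3972),
# line `linear-ph-floor-wagner` — stub 5c `stub_transferArith : TransferArith`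

Supports (does not close) stmt-AtomisticToContinuum-3972. The registered stub `stub_transferArith` of
the skeleton `Cruxes/PeriodicIRBound/Lines/linear-ph-floor-wagner.lean` (statement `TransferArith` in
`Theorems/BECGroundStateSOSPeriodicIRBoundDefs.lean`): for an INTEGRABLE admissible `v`
(`∫ v(|x|) dx < ∞`), the linear particle–hole floor `LinearFloorFor v` (available when `∫v ≠ 0`)
and a Wagner–Feynman moment bound `WagnerFeynmanWith v A` give the crux for `v` in γ-form,
`GroundIRBoundFor v`.

* `∫v = 0` (`TransferArith.groundIRBoundFor_of_lintegral_eq_zero`): `v(|·|) = 0` a.e. on `ℝ³`, so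
  the periodised interaction vanishes for a.e. configuration (`periodicEnergy_eq_ofReal_of_ae` of
  the tree); every periodic energy, the ground-state energy and the ground-state occupations
  `γ_N(k)` coincide with those of the free gas, for which the crux is the landed kinetic Markov
  bound `Negative.irBoundFor_zero` (`irBoundFor_iff_ground`).
* `∫v ≠ 0` (`stub_transferArith`): fix `κ`; along `L_N = (N/ρ)^{1/3}` (`L_N³ = N/ρ`) a window mode
  `0 < ‖k‖_∞ ≤ κ√ρL_N` has dual momentum `p = 2πk/L_N` with `‖p‖ = (2π/L_N)|k|₂`
  (`TransferArith.norm_latticeVec_eq`), hence `‖p‖² ≤ 12π²κ²ρ` and `‖p‖ ≥ 2π‖k‖_∞/L_N`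
  (`‖k‖_∞ ≤ |k|₂ ≤ √3‖k‖_∞`); take the floor at window constant `C := 12π²κ²`, densities below
  `min(ρ₀^floor, ρ₁^Ruelle)` (`exists_eventually_periodicGroundStateEnergy_lt_top`), `N ≥ 2`, and
  the additive floor `θ := 2θ₀√ρ‖p‖ > 0` in the moment bound:
  `γ_N(k) ≤ A(‖p‖² + ρ‖v‖₁)/(2θ₀√ρ‖p‖) ≤ A(√3πκ² + ‖v‖₁/(4π))/θ₀ · √ρL_N/‖k‖_∞`.

Elementary (real/`ℝ≥0∞` arithmetic and filters). References: H. Wagner, Z. Physik 195 (1966) 273;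
S. Stringari, in *Bose–Einstein Condensation* (CUP 1995) §2.2 — for the shape of the moment bound
only; nothing here is cited as a fact.
-/

noncomputable section

open scoped BigOperators ENNReal
open Filter MeasureTheory

namespace Summit.AtomisticToContinuum.BoseEinsteinCondensation.Cruxes.PeriodicIRBound.LinearPhFloorWagner

open Literature.MathematicalPhysics.QuantumManyBody.BoseGas
open Summit.AtomisticToContinuum.BoseEinsteinCondensation.Theorems.PeriodicIRBound.Negative
  (IRBoundFor InWindow groundOccupation GroundIRBoundWith irBoundFor_iff_ground)

open Summit.AtomisticToContinuum.BoseEinsteinCondensation.Theorems.GaussianDominationCan.Negative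
  (nsq nsq_nonneg one_le_norm_intVec)
open Summit.AtomisticToContinuum.BoseEinsteinCondensation.Theorems.PeriodicIRBound.Negative
  (irBoundFor_zero norm_intVec_le_sqrt_nsq sqrt_nsq_le_sqrt_three_mul_norm sqrt_nsq_pos)
open Summit.AtomisticToContinuum.BoseEinsteinCondensation.Cruxes.DensityResponse.ForceBalanceConstitutive
  (periodicEnergy_eq_ofReal_of_ae)

namespace TransferArith

/-! ### The a.e.-free case `∫ v(|x|) dx = 0` -/

/-- If `v(|x|) = 0` for a.e. `x ∈ ℝ³`, the periodic energy of every state is that of the free gas.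
[folklore] -/
theorem periodicEnergy_eq_free_of_ae {v : ℝ → ℝ≥0∞} (hv : Measurable v)
    (h0 : ∀ᵐ x : Space, v ‖x‖ = 0) {N : ℕ} {L : ℝ} (Ψ : PeriodicTrialState N L) :
    periodicEnergy v Ψ = periodicEnergy 0 Ψ := by
  rw [periodicEnergy_eq_ofReal_of_ae hv h0 Ψ,
    periodicEnergy_eq_ofReal_of_ae (w := 0) measurable_const (Eventually.of_forall fun _ => rfl) Ψ]

/-- If `v(|x|) = 0` for a.e. `x ∈ ℝ³`, the periodic ground-state energy is that of the free gas.
[folklore] -/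
theorem periodicGroundStateEnergy_eq_free_of_ae {v : ℝ → ℝ≥0∞} (hv : Measurable v)
    (h0 : ∀ᵐ x : Space, v ‖x‖ = 0) (N : ℕ) (L : ℝ) :
    periodicGroundStateEnergy v N L = periodicGroundStateEnergy 0 N L :=
  iInf_congr fun Ψ => periodicEnergy_eq_free_of_ae hv h0 Ψ

/-- If `v(|x|) = 0` for a.e. `x ∈ ℝ³`, the ground-state occupations are those of the free gas.
[folklore] -/
theorem groundOccupation_eq_free_of_ae {v : ℝ → ℝ≥0∞} (hv : Measurable v)
    (h0 : ∀ᵐ x : Space, v ‖x‖ = 0) (N : ℕ) (L : ℝ) (k : Fin 3 → ℤ) :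
    groundOccupation v N L k = groundOccupation 0 N L k := by
  simp only [groundOccupation, periodicEnergy_eq_free_of_ae hv h0,
    periodicGroundStateEnergy_eq_free_of_ae hv h0]

/-- **The a.e.-free case**: if `∫ v(|x|) dx = 0` then the crux for `v` in γ-form holds, being that of
the free gas (`irBoundFor_zero`, kinetic Markov bound). [folklore] -/
theorem groundIRBoundFor_of_lintegral_eq_zero {v : ℝ → ℝ≥0∞} (hv : Measurable v)
    (h0 : (∫⁻ x : Space, v ‖x‖) = 0) : GroundIRBoundFor v := by
  have hae : ∀ᵐ x : Space, v ‖x‖ = 0 := by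
    have := (lintegral_eq_zero_iff (hv.comp measurable_norm)).1 h0
    filter_upwards [this] with x hx
    simpa using hx
  intro κ hκ
  obtain ⟨ρ₀, hρ₀, C, hC, h⟩ := (irBoundFor_iff_ground 0).1 irBoundFor_zero κ hκ
  refine ⟨ρ₀, hρ₀, C, hC, fun ρ hρ hρρ₀ => ?_⟩
  filter_upwards [h ρ hρ hρρ₀] with N hN k hk
  rw [groundOccupation_eq_free_of_ae hv hae]
  exact hN k hk

/-! ### Window arithmetic -/

/-- `‖c·k‖ = |c|·|k|₂` for the scaled integer vector `latticeVec c k`. [folklore] -/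
theorem norm_latticeVec_eq (c : ℝ) (k : Fin 3 → ℤ) :
    ‖latticeVec c k‖ = |c| * Real.sqrt (nsq k) := by
  rw [EuclideanSpace.norm_eq]
  have : ∑ i, ‖latticeVec c k i‖ ^ 2 = c ^ 2 * nsq k := by
    simp only [nsq, Finset.mul_sum]
    refine Finset.sum_congr rfl fun i _ => ?_
    rw [show latticeVec c k i = c * k i from rfl, Real.norm_eq_abs, sq_abs]
    ring
  rw [this, Real.sqrt_mul (sq_nonneg c), Real.sqrt_sq_eq_abs]

end TransferArith

/-! ### The stub -/

/-- **Stub 5c — window arithmetic and the a.e.-free case.** For an integrable admissible `v`, the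
linear particle–hole floor `C⁺` (when `∫v ≠ 0`) and a Wagner–Feynman bound with some constant `A` give
the crux for `v` in γ-form: along `L_N = (N/ρ)^{1/3}` a window mode `k` has dual momentum `p = 2πk/L_N`
with `‖p‖² ≤ 12π²κ²ρ` and `‖p‖ ≥ 2π‖k‖_∞/L_N`, so the floor `θ = 2θ₀√ρ‖p‖` in the moment bound yields
`γ_N(k) ≤ A(‖p‖² + ρ‖v‖₁)/(2θ₀√ρ‖p‖) ≤ A(√3πκ² + ‖v‖₁/(4π))/θ₀ · √ρ L_N/‖k‖_∞`; for `∫v = 0` the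
occupations are those of the free gas (`TransferArith.groundIRBoundFor_of_lintegral_eq_zero`).
[folklore] -/
theorem stub_transferArith : TransferArith := by
  intro v hv _hint hfloor hWF
  obtain ⟨A, hA, hWF⟩ := hWF
  by_cases h0 : (∫⁻ x : Space, v ‖x‖) = 0
  · exact TransferArith.groundIRBoundFor_of_lintegral_eq_zero hv.1 h0
  have hfl : LinearFloorFor v := hfloor h0
  intro κ hκ
  -- the floor on the window `‖p‖² ≤ 12π²κ²ρ`, and finiteness of `E₀^per` (Ruelle)
  obtain ⟨θ₀, hθ₀, ρf, hρf, Hfl⟩ := hfl (12 * Real.pi ^ 2 * κ ^ 2) (by positivity)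
  obtain ⟨ρ₁, hρ₁, Hfin⟩ :=
    Literature.Barriers.AtomisticToContinuum.BoseGas.exists_eventually_periodicGroundStateEnergy_lt_top
      hv
  set V₁ : ℝ := (∫⁻ x : Space, v ‖x‖).toReal
  have hV₁ : 0 ≤ V₁ := ENNReal.toReal_nonneg
  refine ⟨min ρf ρ₁, lt_min hρf hρ₁,
    A * (Real.sqrt 3 * Real.pi * κ ^ 2 + V₁ / (4 * Real.pi)) / θ₀, by positivity,
    fun ρ hρ hρ₀ => ?_⟩
  filter_upwards [Hfl ρ hρ (hρ₀.trans_le (min_le_left _ _)),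
    Hfin ρ hρ (hρ₀.trans_le (min_le_right _ _)), eventually_ge_atTop 2] with N hflN hfinN hN2
  intro k hk
  -- notation and positivity along `L = L_N(ρ)`
  have hL : 0 < sideLength ρ N := sideLength_pos_of_pos hρ (by omega)
  have hL3 : sideLength ρ N ^ 3 = N / ρ := sideLength_pow_three hρ N
  set L := sideLength ρ N
  have hNL : (N : ℝ) * V₁ / L ^ 3 = ρ * V₁ := by
    rw [hL3]
    field_simp
  have hs : 0 < Real.sqrt ρ := Real.sqrt_pos.2 hρ
  have hs2 : Real.sqrt ρ * Real.sqrt ρ = ρ := Real.mul_self_sqrt hρ.le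
  have hn1 : 1 ≤ ‖(fun j => (k j : ℝ))‖ := one_le_norm_intVec hk.1
  have hn : 0 < ‖(fun j => (k j : ℝ))‖ := one_pos.trans_le hn1
  have hwin : ‖(fun j => (k j : ℝ))‖ ≤ κ * Real.sqrt ρ * L := hk.2
  set n := ‖(fun j => (k j : ℝ))‖
  -- the dual-lattice momentum `p = (2π/L) k`
  set p : Space := latticeVec (2 * Real.pi / L) k with hpdef
  have hc : 0 < 2 * Real.pi / L := by positivity
  have hP : ‖p‖ = 2 * Real.pi / L * Real.sqrt (nsq k) := by
    rw [hpdef, TransferArith.norm_latticeVec_eq, abs_of_pos hc]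
  have hPpos : 0 < ‖p‖ := by
    rw [hP]
    exact mul_pos hc (sqrt_nsq_pos hk.1)
  have hp0 : p ≠ 0 := norm_pos_iff.1 hPpos
  have hPle : ‖p‖ ≤ 2 * Real.pi / L * (Real.sqrt 3 * n) := by
    rw [hP]
    exact mul_le_mul_of_nonneg_left (sqrt_nsq_le_sqrt_three_mul_norm k) hc.le
  have hPge : 2 * Real.pi / L * n ≤ ‖p‖ := by
    rw [hP]
    exact mul_le_mul_of_nonneg_left (norm_intVec_le_sqrt_nsq k) hc.le
  -- the window: `‖p‖ ≤ 2√3πκ√ρ`, so `‖p‖² ≤ 12π²κ²ρ`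
  have hPκ : ‖p‖ ≤ 2 * Real.sqrt 3 * Real.pi * κ * Real.sqrt ρ := by
    calc ‖p‖ ≤ 2 * Real.pi / L * (Real.sqrt 3 * n) := hPle
      _ ≤ 2 * Real.pi / L * (Real.sqrt 3 * (κ * Real.sqrt ρ * L)) := by gcongr
      _ = 2 * Real.sqrt 3 * Real.pi * κ * Real.sqrt ρ := by
          rw [div_mul_eq_mul_div, div_eq_iff hL.ne']
          ring
  have hP2 : ‖p‖ ^ 2 ≤ 12 * Real.pi ^ 2 * κ ^ 2 * ρ := by
    have h3 : Real.sqrt 3 ^ 2 = 3 := Real.sq_sqrt (by norm_num)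
    have hρ2 : Real.sqrt ρ ^ 2 = ρ := Real.sq_sqrt hρ.le
    calc ‖p‖ ^ 2 ≤ (2 * Real.sqrt 3 * Real.pi * κ * Real.sqrt ρ) ^ 2 :=
          pow_le_pow_left₀ (norm_nonneg _) hPκ 2
      _ = 4 * Real.sqrt 3 ^ 2 * Real.pi ^ 2 * κ ^ 2 * Real.sqrt ρ ^ 2 := by ring
      _ = 12 * Real.pi ^ 2 * κ ^ 2 * ρ := by
          rw [h3, hρ2]
          ring
  -- the floor at `p`, fed into the Wagner–Feynman bound, and division by `θ = 2θ₀√ρ‖p‖ > 0`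
  have ht : 0 < 2 * θ₀ * Real.sqrt ρ * ‖p‖ := by positivity
  have hWFp := hWF N L hN2 hL hfinN.ne k hk.1 (2 * θ₀ * Real.sqrt ρ * ‖p‖) ht.le (hflN p hp0 hP2)
  have hγ : groundOccupation v N L k ≤
      ENNReal.ofReal (A * (‖p‖ ^ 2 + N * V₁ / L ^ 3) / (2 * θ₀ * Real.sqrt ρ * ‖p‖)) := by
    rw [ENNReal.ofReal_div_of_pos ht]
    exact (ENNReal.le_div_iff_mul_le (Or.inl (ENNReal.ofReal_pos.2 ht).ne')
      (Or.inl ENNReal.ofReal_ne_top)).2 hWFp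
  refine hγ.trans (ENNReal.ofReal_le_ofReal ?_)
  -- real arithmetic: `A(‖p‖² + ρV₁)/(2θ₀√ρ‖p‖) ≤ A(√3πκ² + V₁/(4π))/θ₀ · √ρ L/‖k‖_∞`
  rw [hNL]
  have step1 : A * (‖p‖ ^ 2 + ρ * V₁) / (2 * θ₀ * Real.sqrt ρ * ‖p‖) =
      A / (2 * θ₀) * (‖p‖ / Real.sqrt ρ + Real.sqrt ρ * V₁ / ‖p‖) := by
    rw [div_add_div _ _ hs.ne' hPpos.ne']
    have : ‖p‖ * ‖p‖ + Real.sqrt ρ * (Real.sqrt ρ * V₁) = ‖p‖ ^ 2 + ρ * V₁ := by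
      linear_combination V₁ * hs2
    rw [this, div_mul_div_comm]
    ring
  have step2 : ‖p‖ / Real.sqrt ρ ≤ 2 * Real.sqrt 3 * Real.pi * κ ^ 2 * Real.sqrt ρ * L / n := by
    rw [div_le_div_iff₀ hs hn]
    calc ‖p‖ * n ≤ 2 * Real.pi / L * (Real.sqrt 3 * n) * n :=
          mul_le_mul_of_nonneg_right hPle hn.le
      _ = 2 * Real.sqrt 3 * Real.pi / L * (n * n) := by ring
      _ ≤ 2 * Real.sqrt 3 * Real.pi / L * ((κ * Real.sqrt ρ * L) * (κ * Real.sqrt ρ * L)) := by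
          gcongr
      _ = 2 * Real.sqrt 3 * Real.pi * κ ^ 2 * Real.sqrt ρ * L * Real.sqrt ρ := by
          rw [div_mul_eq_mul_div, div_eq_iff hL.ne']
          ring
  have step3 : Real.sqrt ρ * V₁ / ‖p‖ ≤ Real.sqrt ρ * V₁ * L / (2 * Real.pi * n) := by
    calc Real.sqrt ρ * V₁ / ‖p‖ ≤ Real.sqrt ρ * V₁ / (2 * Real.pi / L * n) :=
          div_le_div_of_nonneg_left (by positivity) (by positivity) hPge
      _ = Real.sqrt ρ * V₁ * L / (2 * Real.pi * n) := by
          rw [div_mul_eq_mul_div, div_div_eq_mul_div]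
  rw [step1]
  calc A / (2 * θ₀) * (‖p‖ / Real.sqrt ρ + Real.sqrt ρ * V₁ / ‖p‖)
      ≤ A / (2 * θ₀) * (2 * Real.sqrt 3 * Real.pi * κ ^ 2 * Real.sqrt ρ * L / n +
          Real.sqrt ρ * V₁ * L / (2 * Real.pi * n)) :=
        mul_le_mul_of_nonneg_left (add_le_add step2 step3) (by positivity)
    _ = A * (Real.sqrt 3 * Real.pi * κ ^ 2 + V₁ / (4 * Real.pi)) / θ₀ * Real.sqrt ρ * L / n := by
        field_simp
        ring

end Summit.AtomisticToContinuum.BoseEinsteinCondensation.Cruxes.PeriodicIRBound.LinearPhFloorWagner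

end
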